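/-
Copyright (c) 2026 the pub-hodgecm-mathlib formalisation cell (harness21).  Prover seat hodgecm-mathlib-K2E1-p10 (g0), Track B ∕ K2-LIT, h413 = `stmt-HodgeConjecture-24833`,
line `K2_E1_TraceFormulaBeta`, campaign «EIS-R7-BL-SPH-3», deal (44) «CLOSER₃» FILE (a) of the dealer K2E1-plan (g6) (2026-09-04T10:09:31Z; REPORT-FIRST 10:2xZ): the `σ₀`-edition of ★ G-a's
gluing `exists_meromorphicOn_univ_of_balls` and the N = 3 twin of ★ P8 §1 `sphericalEisenstein_meromorphic_of_balls` (Godement half-plane `{2 < Re z}`).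
-/
import Summits.HodgeConjecture.HodgeConjecture.Theorems.K2E1BLMeromorphicGluing               -- ★ G-a (K2E3-p12): `exists_meromorphicNFOn_univ_of_exhaustion` (generic exhaustion gluing)
import Summits.HodgeConjecture.HodgeConjecture.Theorems.K2E1BorelEisensteinRegularCMThree      -- ★ (K2E1-p09): `differentiableOn_eisensteinSeriesU_flatSectionU_cm_three` (holomorphy on `{2 < Re z}`)
import HarnessLib

/-!
# K2·E1 — `K2E1BLMeromorphicGluingOfLt`: GLUING MEROMORPHIC PIECES ON BALLS THAT AGREE WITH A HOLOMORPHIC FUNCTION ON A GENERAL HALF-PLANE `{σ₀ < Re z}`, AND THE WHOLE-PLANE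
# CONTINUATION OF THE SPHERICAL BOREL EISENSTEIN SERIES ON `U(2,1)` OVER A CM FIELD FROM PER-BALL CONTINUATIONS (Godement half-plane `{2 < Re z}`)

Track B ∕ K2-LIT, crux h413 = `stmt-HodgeConjecture-24833`, route of record `HCCMUnconditional`; cell `hodgecm-mathlib`, squad K2, ENGINE E1 (campaign «EIS-R7-BL-SPH-3», closer₃).
THEOREMS ONLY (no `def`, no `instance`, no notation, no named-fact hypothesis, no `sorry`; default heartbeats); lane `--supports stmt-HodgeConjecture-24833 --as helper` (count-neutral).
★ G-a `K2E1BLMeromorphicGluing.exists_meromorphicOn_univ_of_balls` and ★ P8 §1 `K2E1SphericalEisensteinMeromorphicOfBallsU2.sphericalEisenstein_meromorphic_of_balls` hard-wire the Godement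
half-plane `{1 < Re z}` of `U(1,1)` (base point `3∕2 ∈ ball 0 2`).  For `U(2,1)` the Eisenstein series converges on `{2 < Re z}` (★ `differentiableOn_eisensteinSeriesU_flatSectionU_cm_three`),
and `ball 0 2 ∩ {2 < Re z} = ∅`: either the pieces live on the balls `ball 0 (n + R₀)` with `R₀ ≥ σ₀ + 1`, or — the convention of the ★ ball suppliers — on `ball 0 (n + 2)` for
`n ≥ n₀` only, `σ₀ ≤ n₀ + 1`; in both cases `σ₀ + ½` is a common base point.  Both statements below are ★ G-a's
exhaustion lemma `exists_meromorphicNFOn_univ_of_exhaustion` (generic open exhaustion, any open set `O`, any base point in `D 0 ∩ O`) specialised — no new analysis.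
* §1 **`exists_meromorphicOn_univ_of_balls_of_lt`** (`σ₀ ≥ 0`, `R₀ ≥ σ₀ + 1`, pieces on `ball 0 (n + R₀)` agreeing with `g` holomorphic on `{σ₀ < Re z}`),
  **`exists_meromorphicOn_univ_of_eventually_balls_of_lt`** (fixed radius `n + 2`, pieces for `n ≥ n₀`, `σ₀ ≤ n₀ + 1`);
  §2 **`sphericalEisenstein_meromorphic_of_eventually_balls_cm_three`** (`σ₀ = 2`: pieces on `ball 0 (n + 2)`, `n ≥ n₀ ≥ 1`, agreeing with `E(φ₀H^z)(g)` on `{2 < Re z}` ⟹ ONE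
  `Ec : ℂ → (G → ℂ)` meromorphic on `ℂ` in `z` for every `g` with `Ec z = E(φ₀H^z)` for `2 < Re z`) — the HEAD of the closer₃ with the per-ball conclusion as its only hypothesis.
HONEST LABEL: HC_CM is proved only modulo the 7 printed citations (2 remaining named inputs: hLiu418 = `stmt-HodgeConjecture-24832`, h413 = `stmt-HodgeConjecture-24833`)
until rung 0 closes; this file asserts no named fact, closes no socket and crosses no ceiling by itself; count-neutral.  NOT claimed: location of poles, functional equation.
References: [BernsteinLapid2019] J. Bernstein, E. Lapid, *On the meromorphic continuation of Eisenstein series*, arXiv:1911.02342 (JAMS 37 (2024)), §2.1 and §4 p. 10 ·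
[MoeglinWaldspurger1995] C. Mœglin, J.-L. Waldspurger, *Spectral Decomposition and Eisenstein Series*, II.1.5, IV.1.8.
-/

set_option autoImplicit false
-- the mandated namespace repeats `HodgeConjecture.HodgeConjecture`, as in every `Theorems/*.lean` of this sub-problem
set_option linter.dupNamespace false

noncomputable section

open Set Filter Topology NumberField
open Literature.NumberTheory.Automorphic Literature.NumberTheory.Automorphic.UnitaryGroup
open Summit.HodgeConjecture.HodgeConjecture.Cruxes.H413.K2E1BorelEisensteinU
open Summit.HodgeConjecture.HodgeConjecture.Cruxes.H413.K2E1BLMeromorphicGluing (exists_meromorphicNFOn_univ_of_exhaustion)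
open Summit.HodgeConjecture.HodgeConjecture.Cruxes.H413.K2E1BorelEisensteinRegularCMThree (differentiableOn_eisensteinSeriesU_flatSectionU_cm_three)

namespace Summit.HodgeConjecture.HodgeConjecture.Cruxes.H413.K2E1BLMeromorphicGluingOfLt

/-! ## §1 Gluing over balls against a general half-plane -/

/-- **GLUING AGAINST THE HALF-PLANE `{σ₀ < Re z}`** [BernsteinLapid2019, §2.1 + §4 p. 10].  `σ₀ ≥ 0`, `R₀ ≥ σ₀ + 1`; `g` holomorphic on `{σ₀ < Re z}`; for every `n` a piece `F n`
meromorphic on `ball 0 (n + R₀)` equal to `g` on `ball 0 (n + R₀) ∩ {σ₀ < Re z}`.  THEN some `G` is meromorphic on ALL of `ℂ`, equals `g` on `{σ₀ < Re z}`, and is eventually (in the punctured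
sense) each piece near every point of its ball (★ G-a `exists_meromorphicNFOn_univ_of_exhaustion` with base point `σ₀ + ½ ∈ ball 0 R₀`). [cite: BernsteinLapid2019, §2.1 and §4 p. 10] -/
theorem exists_meromorphicOn_univ_of_balls_of_lt {𝓥 : Type*} [NormedAddCommGroup 𝓥] [NormedSpace ℂ 𝓥] [CompleteSpace 𝓥] {σ₀ R₀ : ℝ} (hσ₀ : 0 ≤ σ₀) (hR₀ : σ₀ + 1 ≤ R₀)
    {g : ℂ → 𝓥} (hg : DifferentiableOn ℂ g {z : ℂ | σ₀ < z.re})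
    {F : ℕ → ℂ → 𝓥} (hF : ∀ n : ℕ, MeromorphicOn (F n) (Metric.ball (0 : ℂ) (n + R₀)))
    (hFg : ∀ n : ℕ, ∀ z ∈ Metric.ball (0 : ℂ) (n + R₀), σ₀ < z.re → F n z = g z) :
    ∃ G : ℂ → 𝓥, MeromorphicOn G univ ∧ (∀ z : ℂ, σ₀ < z.re → G z = g z) ∧ ∀ n : ℕ, ∀ z ∈ Metric.ball (0 : ℂ) (n + R₀), G =ᶠ[𝓝[≠] z] F n := by
  have hO : IsOpen {z : ℂ | σ₀ < z.re} := isOpen_lt continuous_const Complex.continuous_re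
  have hz₁ : ((σ₀ + 1 / 2 : ℝ) : ℂ) ∈ Metric.ball (0 : ℂ) ((0 : ℕ) + R₀) ∩ {z : ℂ | σ₀ < z.re} := by
    refine ⟨?_, ?_⟩
    · rw [Metric.mem_ball, dist_zero_right, Complex.norm_real, Real.norm_eq_abs, abs_of_nonneg (by linarith), Nat.cast_zero, zero_add]
      linarith
    · show σ₀ < ((σ₀ + 1 / 2 : ℝ) : ℂ).re
      rw [Complex.ofReal_re]
      linarith
  have hcov : ∀ z : ℂ, ∃ n : ℕ, z ∈ Metric.ball (0 : ℂ) (n + R₀) := fun z => by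
    obtain ⟨n, hn⟩ := exists_nat_gt ‖z‖
    refine ⟨n, ?_⟩
    rw [Metric.mem_ball, dist_zero_right]
    linarith
  have hmono : Monotone fun n : ℕ => Metric.ball (0 : ℂ) (n + R₀) := fun n m hnm =>
    Metric.ball_subset_ball (by simpa using (Nat.cast_le (α := ℝ)).2 hnm)
  obtain ⟨G, hG, hGg, hGF⟩ := exists_meromorphicNFOn_univ_of_exhaustion (D := fun n : ℕ => Metric.ball (0 : ℂ) (n + R₀)) (fun n => Metric.isOpen_ball)
    (fun n => (convex_ball (0 : ℂ) _).isPreconnected) hmono hcov hO hz₁ (hg.analyticOnNhd hO) hF (fun n z hz => hFg n z hz.1 hz.2)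
  exact ⟨G, hG.meromorphicOn, fun z hz => hGg hz, hGF⟩

/-- **FIXED RADIUS, EVENTUALLY** (the form the ★ ball suppliers use: balls `ball 0 (n + 2)`, pieces only for `n ≥ n₀` with `σ₀ ≤ n₀ + 1`): same conclusion on `{σ₀ < Re z}`
(§1 with `R₀ = n₀ + 2` and the pieces re-indexed `m ↦ F (m + n₀)`). [cite: BernsteinLapid2019, §2.1 and §4 p. 10] -/
theorem exists_meromorphicOn_univ_of_eventually_balls_of_lt {𝓥 : Type*} [NormedAddCommGroup 𝓥] [NormedSpace ℂ 𝓥] [CompleteSpace 𝓥] {σ₀ : ℝ} (hσ₀ : 0 ≤ σ₀)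
    (n₀ : ℕ) (hn₀ : σ₀ ≤ n₀ + 1) {g : ℂ → 𝓥} (hg : DifferentiableOn ℂ g {z : ℂ | σ₀ < z.re})
    {F : ℕ → ℂ → 𝓥} (hF : ∀ n : ℕ, n₀ ≤ n → MeromorphicOn (F n) (Metric.ball (0 : ℂ) (n + 2)))
    (hFg : ∀ n : ℕ, n₀ ≤ n → ∀ z ∈ Metric.ball (0 : ℂ) (n + 2), σ₀ < z.re → F n z = g z) :
    ∃ G : ℂ → 𝓥, MeromorphicOn G univ ∧ (∀ z : ℂ, σ₀ < z.re → G z = g z) ∧ ∀ n : ℕ, n₀ ≤ n → ∀ z ∈ Metric.ball (0 : ℂ) (n + 2), G =ᶠ[𝓝[≠] z] F n := by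
  have hrad : ∀ m : ℕ, ((m : ℝ) + ((n₀ : ℝ) + 2)) = (((m + n₀ : ℕ) : ℝ) + 2) := fun m => by push_cast; ring
  obtain ⟨G, hG, hGg, hGF⟩ := exists_meromorphicOn_univ_of_balls_of_lt (σ₀ := σ₀) (R₀ := (n₀ : ℝ) + 2) hσ₀ (by linarith) hg (F := fun m => F (m + n₀))
    (fun m => by rw [hrad]; exact hF (m + n₀) (Nat.le_add_left _ _)) (fun m z hz hzσ => hFg (m + n₀) (Nat.le_add_left _ _) z (by rwa [hrad] at hz) hzσ)
  refine ⟨G, hG, hGg, fun n hn z hz => ?_⟩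
  obtain ⟨m, rfl⟩ := Nat.exists_eq_add_of_le' hn
  exact hGF m z (by rwa [hrad])

/-! ## §2 `U(2,1)` over a CM field: the whole plane from the balls -/

section CMThree

variable (L : Type) [Field L] [NumberField L] [IsCMField L]

/-- **WHOLE PLANE FROM THE BALLS, `U(2,1)`** [BernsteinLapid2019, §2.1 + §4 p. 10] — in the radius∕weight convention of ★ BallData₃ (`ball 0 (n + 2)`): if for every `n ≥ n₀` (some `n₀ ≥ 1`)
and every `g ∈ U(J₃)(𝔸_{L⁺})` some scalar function meromorphic on `ball 0 (n + 2)` agrees with `z ↦ E(φ₀H^z)(g)` on `ball 0 (n + 2) ∩ {2 < Re z}`, then there is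
`Ec : ℂ → (U(J₃)(𝔸_{L⁺}) → ℂ)`, meromorphic on ALL of `ℂ` in `z` for every `g`, with `Ec z = E(φ₀H^z)` for `2 < Re z` (§1 at `σ₀ = 2`; the base point `5∕2` lies in `ball 0 (n + 2)` iff `n ≥ 1`;
holomorphy of the Eisenstein series on the Godement range ★ `differentiableOn_eisensteinSeriesU_flatSectionU_cm_three`). [cite: BernsteinLapid2019, §2.1 and §4 p. 10] [cite: MoeglinWaldspurger1995, II.1.5] -/
theorem sphericalEisenstein_meromorphic_of_eventually_balls_cm_three (φ₀ : ℂ) (n₀ : ℕ) (hn₀ : 1 ≤ n₀)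
    (hball : ∀ n : ℕ, n₀ ≤ n → ∀ g : (quasiSplit (↥(maximalRealSubfield L)) L (IsCMField.complexConj L) 3).Adelic, ∃ Ec : ℂ → ℂ,
      MeromorphicOn Ec (Metric.ball (0 : ℂ) (n + 2)) ∧ ∀ z ∈ Metric.ball (0 : ℂ) (n + 2), 2 < z.re →
        Ec z = eisensteinSeriesU (flatSectionU (fun _ : (quasiSplit (↥(maximalRealSubfield L)) L (IsCMField.complexConj L) 3).Adelic => φ₀) z) g) :
    ∃ Ec : ℂ → (quasiSplit (↥(maximalRealSubfield L)) L (IsCMField.complexConj L) 3).Adelic → ℂ,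
      (∀ g, MeromorphicOn (fun z => Ec z g) univ) ∧
      ∀ z : ℂ, 2 < z.re → Ec z = eisensteinSeriesU (flatSectionU (fun _ : (quasiSplit (↥(maximalRealSubfield L)) L (IsCMField.complexConj L) 3).Adelic => φ₀) z) := by
  have hglue : ∀ g : (quasiSplit (↥(maximalRealSubfield L)) L (IsCMField.complexConj L) 3).Adelic, ∃ G : ℂ → ℂ, MeromorphicOn G univ ∧
      ∀ z : ℂ, 2 < z.re → G z = eisensteinSeriesU (flatSectionU (fun _ : (quasiSplit (↥(maximalRealSubfield L)) L (IsCMField.complexConj L) 3).Adelic => φ₀) z) g := by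
    intro g
    have hch : ∀ n : ℕ, ∃ Ec : ℂ → ℂ, n₀ ≤ n → MeromorphicOn Ec (Metric.ball (0 : ℂ) (n + 2)) ∧ ∀ z ∈ Metric.ball (0 : ℂ) (n + 2), 2 < z.re →
        Ec z = eisensteinSeriesU (flatSectionU (fun _ : (quasiSplit (↥(maximalRealSubfield L)) L (IsCMField.complexConj L) 3).Adelic => φ₀) z) g := fun n => by
      by_cases hn : n₀ ≤ n
      · obtain ⟨Ec, h1, h2⟩ := hball n hn g
        exact ⟨Ec, fun _ => ⟨h1, h2⟩⟩
      · exact ⟨fun _ => 0, fun h => absurd h hn⟩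
    choose F hF using hch
    have hn₀' : (2 : ℝ) ≤ (n₀ : ℝ) + 1 := by
      have : (1 : ℝ) ≤ n₀ := by exact_mod_cast hn₀
      linarith
    obtain ⟨G, hG, hGE, -⟩ := exists_meromorphicOn_univ_of_eventually_balls_of_lt (σ₀ := 2) (by norm_num) n₀ hn₀'
      (differentiableOn_eisensteinSeriesU_flatSectionU_cm_three L (φ := fun _ => φ₀) (M := ‖φ₀‖) (fun _ => le_rfl) g)
      (fun n hn => (hF n hn).1) (fun n hn => (hF n hn).2)
    exact ⟨G, hG, hGE⟩
  choose G hG hGE using hglue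
  exact ⟨fun z g => G g z, hG, fun z hz => funext fun g => hGE g z hz⟩

end CMThree

end Summit.HodgeConjecture.HodgeConjecture.Cruxes.H413.K2E1BLMeromorphicGluingOfLt

end
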